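import Summits.HodgeConjecture.HodgeConjecture.Theorems.EightfoldBlochSeedsChernCharacterOnBettiAnalytificationCharacter
import Summits.HodgeConjecture.HodgeConjecture.Theorems.EightfoldBlochSeedsChernCharacterOnBettiAnalytificationRank
import Literature.AlgebraicGeometry.HodgeTheory.SectionFramesOfTrivialisations
import HarnessLib

/-!
# K1 (analytification bridge), step K1d: analytifications under the hypotheses of `ChernCharacterBetti`
# (`Motives.IsVectorBundle`, `Motives.HasRankLE`) on a smooth projective `X`

Route `EightfoldBlochSeeds` / item `stmt-HodgeConjecture-19780` (`ChernCharacterOnBetti`), helper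
(`--supports`). HONEST FRAMING: nothing here proves 19780 / 18880 / 18882 / 18883 / H2 / HC_AV / HC;
no definition, no named fact.

WHAT. The fields of `ChernCharacterBetti` are hypothesised on Mathlib's vector bundles
(`Motives.IsVectorBundle E = IsLocallyFree ∧ IsFiniteType`) and on `Motives.HasRankLE L 1`; the
existence theorem of the analytification (step 2 / step 6, `exists_topologicalAnalytification_of_
isSmoothProjective`) is hypothesised on the sections-side `HodgeTheory.IsFinLocallyFreeOn F ⊤`. The
Literature dictionary `HodgeTheory.isFinLocallyFreeOn_top_of_isVectorBundle` (new,
`SectionFramesOfTrivialisations`) closes the gap: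

* `exists_topologicalAnalytification_of_isVectorBundle` — every vector bundle `F` on a smooth
  projective `X` has a rank `r`, algebraic frames of size `r` near every point, and a topological
  analytification `(E, α)` of rank `r` with Serre's five properties;
* `exists_topologicalAnalytification_of_hasRankLE` — for `HasRankLE F r₀` the rank satisfies `r ≤ r₀`
  (frames sharing a point have the same size, `frame_card_eq`); for `r₀ = 1` this is the hypothesis
  `E.rank ≤ 1` of `topologicalChernCharacter_succ_of_rank_le_one` (field `ch_of_hasRankLE_one`);
* `exists_analytification_chernCharacter_of_isVectorBundle` — packaged: for a vector bundle `F` on a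
  smooth projective `X` there is an analytification whose Chern character
  `ch_k = theChernClassTheory.topologicalChernCharacter ℂ E k ∈ complexBetti X (2 * k)` is a rational
  class for every `k`, lies in `N¹` for `k ≥ 1`, has `ch₁` algebraic, and is THE SAME for any other
  analytification datum of `F` (K1b).

[cite: SerreGAGA1956, §3 n°9 Déf. 2, Prop. 10 and §4 n°20] [cite: StacksProject, Tag 01C6]
[cite: Hirzebruch1966, §10.1]
-/

noncomputable section

-- single-problem summit (Problem = Summit): the mandated namespace repeats `HodgeConjecture`.
set_option linter.dupNamespace false

open CategoryTheory AlgebraicGeometry Bundle Topology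
open Literature.AlgebraicGeometry.Motives Literature.AlgebraicGeometry.HodgeTheory
open Literature.AlgebraicTopology.SingularHomology Literature.AlgebraicTopology.CharacteristicClasses

namespace Summit.HodgeConjecture.HodgeConjecture.Theorems

variable {n : ℕ} {X : SchemeOver ℂ} {F : X.left.Modules}

/-- **Every vector bundle on a smooth projective `X` has a topological analytification**: a rank `r`,
algebraic frames of size `r` near every point, a complex vector bundle `E` of rank `r` on `X(ℂ)` and
Serre's comparison maps `α` (additive, `𝒪_X`-linear, restriction-compatible, continuous on `U(ℂ)`,
frames ↦ bases). [cite: SerreGAGA1956, §3 n°9 Déf. 2 and §4 n°20] [cite: StacksProject, Tag 01C6] -/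
theorem exists_topologicalAnalytification_of_isVectorBundle (hX : IsSmoothProjective n X)
    (hF : IsVectorBundle F) :
    ∃ (r : ℕ) (E : ComplexVectorBundle.{0, 0} (ComplexPoints X))
      (α : ∀ U : X.left.Opens, Γ(F, U) → ∀ P : ComplexPoints X, E.E P),
      E.rank = r ∧
      (∀ x : X.left, ∃ (U : X.left.Opens) (s : Fin r → Γ(F, U)), x ∈ U ∧ IsSectionFrame F U s) ∧
      (∀ (U : X.left.Opens) (σ τ : Γ(F, U)) (P : ComplexPoints X),
          α U (σ + τ) P = α U σ P + α U τ P) ∧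
      (∀ (U : X.left.Opens) (f : Γ(X.left, U)) (σ : Γ(F, U)) (P : ComplexPoints X) (h : P.pt ∈ U),
          α U (f • σ) P = P.eval U h f • α U σ P) ∧
      (∀ (U W : X.left.Opens) (hWU : W ≤ U) (σ : Γ(F, U)) (P : ComplexPoints X), P.pt ∈ W →
          α W (F.presheaf.map (homOfLE hWU).op σ) P = α U σ P) ∧
      (∀ (U : X.left.Opens) (σ : Γ(F, U)),
          ContinuousOn (fun P ↦ (⟨P, α U σ P⟩ : TotalSpace E.F E.E)) {P | P.pt ∈ U}) ∧
      (∀ (U : X.left.Opens) (t : Fin r → Γ(F, U)), IsSectionFrame F U t → ∀ P : ComplexPoints X,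
          P.pt ∈ U → LinearIndependent ℂ (fun j ↦ α U (t j) P) ∧
            ⊤ ≤ Submodule.span ℂ (Set.range fun j ↦ α U (t j) P)) :=
  exists_topologicalAnalytification_of_isSmoothProjective hX (isFinLocallyFreeOn_top_of_isVectorBundle hF)

/-- **For `HasRankLE F r₀` the analytification has rank `≤ r₀`** (its rank is the common size of the
algebraic frames, and a `HasRankLE` datum supplies a frame of size `≤ r₀` at any point).
[cite: SerreGAGA1956, §3 n°9 Déf. 2 and §4 n°20] [cite: StacksProject, Tag 01C6] -/
theorem exists_topologicalAnalytification_of_hasRankLE (hX : IsSmoothProjective n X) {r₀ : ℕ}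
    (hF : HasRankLE F r₀) :
    ∃ (r : ℕ) (E : ComplexVectorBundle.{0, 0} (ComplexPoints X))
      (α : ∀ U : X.left.Opens, Γ(F, U) → ∀ P : ComplexPoints X, E.E P),
      r ≤ r₀ ∧ E.rank = r ∧
      (∀ x : X.left, ∃ (U : X.left.Opens) (s : Fin r → Γ(F, U)), x ∈ U ∧ IsSectionFrame F U s) ∧
      (∀ (U : X.left.Opens) (σ τ : Γ(F, U)) (P : ComplexPoints X),
          α U (σ + τ) P = α U σ P + α U τ P) ∧
      (∀ (U : X.left.Opens) (f : Γ(X.left, U)) (σ : Γ(F, U)) (P : ComplexPoints X) (h : P.pt ∈ U),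
          α U (f • σ) P = P.eval U h f • α U σ P) ∧
      (∀ (U W : X.left.Opens) (hWU : W ≤ U) (σ : Γ(F, U)) (P : ComplexPoints X), P.pt ∈ W →
          α W (F.presheaf.map (homOfLE hWU).op σ) P = α U σ P) ∧
      (∀ (U : X.left.Opens) (σ : Γ(F, U)),
          ContinuousOn (fun P ↦ (⟨P, α U σ P⟩ : TotalSpace E.F E.E)) {P | P.pt ∈ U}) ∧
      (∀ (U : X.left.Opens) (t : Fin r → Γ(F, U)), IsSectionFrame F U t → ∀ P : ComplexPoints X,
          P.pt ∈ U → LinearIndependent ℂ (fun j ↦ α U (t j) P) ∧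
            ⊤ ≤ Submodule.span ℂ (Set.range fun j ↦ α U (t j) P)) := by
  haveI := IsSmoothProjective.isIntegral_holds hX
  obtain ⟨r, E, α, hrank, hfr, hadd, hsmul, hres, hcont, hframe⟩ :=
    exists_topologicalAnalytification_of_isSmoothProjective hX (isFinLocallyFreeOn_top_of_hasRankLE hF)
  obtain ⟨x₀⟩ := (inferInstance : Nonempty X.left)
  obtain ⟨U', r', s', hr', hx', hs'⟩ := exists_isSectionFrame_card_le_of_hasRankLE hF x₀
  obtain ⟨U, s, hx, hs⟩ := hfr x₀
  obtain rfl : r = r' := frame_card_eq hs hs' hx hx'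
  exact ⟨r, E, α, hr', hrank, hfr, hadd, hsmul, hres, hcont, hframe⟩

/-- **K1 for vector bundles, packaged.** For a vector bundle `F` on a smooth projective `X` over `ℂ`
there is a topological analytification `(E, α)` (of some rank `r`, with algebraic frames of size `r`
near every point) such that, writing `ch_k(E) = theChernClassTheory.topologicalChernCharacter ℂ E k ∈
complexBetti X (2 * k)`: every `ch_k(E)` is a rational class; `ch_k(E) ∈ N¹ H²ᵏ(X(ℂ); ℂ)` for
`k ≥ 1`; `ch₁(E)` is an algebraic class; and `ch_k(E') = ch_k(E)` for EVERY other analytification datum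
`(E', α')` of `F` with frames of size `r`. [cite: SerreGAGA1956, §3 n°9 Déf. 2, Prop. 10 and §4 n°20]
[cite: Hirzebruch1966, §10.1] [cite: BlochOgus1974ENS, (3.8)] -/
theorem exists_analytification_chernCharacter_of_isVectorBundle (hX : IsSmoothProjective n X)
    (hF : IsVectorBundle F) :
    ∃ (r : ℕ) (E : ComplexVectorBundle.{0, 0} (ComplexPoints X))
      (α : ∀ U : X.left.Opens, Γ(F, U) → ∀ P : ComplexPoints X, E.E P),
      E.rank = r ∧
      (∀ x : X.left, ∃ (U : X.left.Opens) (s : Fin r → Γ(F, U)), x ∈ U ∧ IsSectionFrame F U s) ∧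
      (∀ (U : X.left.Opens) (σ : Γ(F, U)) (P : ComplexPoints X), P.pt ∈ U →
          ContinuousOn (fun P ↦ (⟨P, α U σ P⟩ : TotalSpace E.F E.E)) {P | P.pt ∈ U}) ∧
      (∀ k : ℕ, IsRationalClass (theChernClassTheory.topologicalChernCharacter ℂ E k : complexBetti X (2 * k))) ∧
      (∀ k : ℕ, 0 < k → theChernClassTheory.topologicalChernCharacter ℂ E k ∈ coniveauFiltration ℂ X (2 * k) 1) ∧
      theChernClassTheory.topologicalChernCharacter ℂ E 1 ∈ algebraicClasses X 1 ∧
      (∀ (E' : ComplexVectorBundle.{0, 0} (ComplexPoints X))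
        (α' : ∀ U : X.left.Opens, Γ(F, U) → ∀ P : ComplexPoints X, E'.E P),
        (∀ (U : X.left.Opens) (σ τ : Γ(F, U)) (P : ComplexPoints X), α' U (σ + τ) P = α' U σ P + α' U τ P) →
        (∀ (U : X.left.Opens) (f : Γ(X.left, U)) (σ : Γ(F, U)) (P : ComplexPoints X) (h : P.pt ∈ U),
          α' U (f • σ) P = P.eval U h f • α' U σ P) →
        (∀ (U W : X.left.Opens) (hWU : W ≤ U) (σ : Γ(F, U)) (P : ComplexPoints X), P.pt ∈ W →
          α' W (F.presheaf.map (homOfLE hWU).op σ) P = α' U σ P) →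
        (∀ (U : X.left.Opens) (σ : Γ(F, U)),
          ContinuousOn (fun P ↦ (⟨P, α' U σ P⟩ : TotalSpace E'.F E'.E)) {P | P.pt ∈ U}) →
        (∀ (U : X.left.Opens) (t : Fin r → Γ(F, U)), IsSectionFrame F U t →
          ∀ P : ComplexPoints X, P.pt ∈ U → LinearIndependent ℂ (fun j ↦ α' U (t j) P) ∧
            ⊤ ≤ Submodule.span ℂ (Set.range fun j ↦ α' U (t j) P)) →
        ∀ k : ℕ, theChernClassTheory.topologicalChernCharacter ℂ E' k =
          theChernClassTheory.topologicalChernCharacter ℂ E k) := by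
  haveI := IsSmoothProjective.isIntegral_holds hX
  obtain ⟨r, E, α, hrank, hfr, hadd, hsmul, hres, hcont, hframe⟩ :=
    exists_topologicalAnalytification_of_isVectorBundle hX hF
  obtain ⟨x₀⟩ := (inferInstance : Nonempty X.left)
  obtain ⟨U₀, s₀, hx₀, hs₀⟩ := hfr x₀
  have hU₀ : (U₀ : Set X.left).Nonempty := ⟨x₀, hx₀⟩
  refine ⟨r, E, α, hrank, hfr, fun U σ P _ ↦ hcont U σ, fun k ↦ isRationalClass_topologicalChernCharacter E k,
    fun k hk ↦ topologicalChernCharacter_mem_coniveauFiltration_one_of_comparison hX E α hcont hframe hU₀ hs₀ hk,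
    topologicalChernCharacter_one_mem_algebraicClasses_of_comparison hX E α hcont hframe hU₀ hs₀,
    fun E' α' hadd' hsmul' hres' hcont' hframe' k ↦ ?_⟩
  exact topologicalChernCharacter_eq_of_comparison hX hfr E' E α' α hadd' hsmul' hres' hcont' hframe'
    hadd hsmul hres hcont hframe k

end Summit.HodgeConjecture.HodgeConjecture.Theorems

end
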